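import Literature.MathematicalPhysics.QuantumFieldTheory.Balaban1983to89.B13EntryLetterAlgebra

/-!
# `Balaban1983to89.B13EntryLetterSockets` — T. Bałaban, *Propagators for lattice gauge theories in a background field*, Commun. Math.
Phys. **99** (1985) 389–434 [Balaban1985BackgroundPropagators], Thm 3.10 (3.107)–(3.108) p. 416 (the class of kernels with
`|G(x,x′)| ≤ Be^{−δd(x,x′)}`, analytic in the background on the complex domain (3.36) p. 396); *Renormalization group approach to lattice
gauge field theories. II. Cluster expansions*, Commun. Math. Phys. **116** (1988) 1–22 [Balaban1988RG2Cluster], p. 15 («We consider it as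
an analytic function of (𝐔, 𝐉) in the space 𝐔^c_{k+1}(X, α₀, α₁), and of the complex parameters σ(Z), τ») and (2.5) p. 12 (the operators
of the expansion are read through the unit-lattice distance of their localizations): THE THREE SOCKETS OF AN ENTRYWISE-LETTERS DATUM —
chart, index, reading.

statement-level bookkeeping over the landed `B13EntrywiseWalks.RawEntryLetters` ∕ `B13EntryLetterAlgebra` with citation tags; kernel-checked;
[folklore] complex analysis (composition of holomorphic maps) and the triangle inequality; nothing here is a claim about the Yang–Mills
mass gap; nothing of Bałaban's operators is constructed or asserted; no node is discharged; count-neutral.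

WHY THIS FILE (cell `pub-ymgap`, HUMAN RULING D-0062, Track A node N10 = [Balaban1988RG2Cluster]; width seat `pub-ymgap-dag-n10-w3` g5;
lane census `N10-RESIDUAL-CENSUS-v20.md` INTENT-0).  The N10 junction of record («67V»,
`Summits/…/BalabanUVNodesN10B13KernelTowerWalksEntrywiseNumeralsDecoratedDialsLocatedVol`) displays, per term `(Z, t)` of the decorated tower
`lamD`, ONE letters datum `hEL : RawEntryLetters (lamD.Δ₀ Z t) (lamD.locF Z t) rf.R ρΔ BΔ` on the term's OWN chart `lamD.E₃`, index `lamD.P Z t`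
and reading `lamD.locF Z t : lamD.P Z t → UT lamD.Nf`.  The lane's located inverse road (`G′ → X⁻¹ → R → Δ_a → G` on the class (3.35)) CONCLUDES
letters data on ANOTHER chart (the `A′`-space of a pencil `A′ ↦ e^{iηA′}U₀` about a background `U₀`), ANOTHER index (`FBondY i × (Fin N × Fin N)`)
and ANOTHER reading (`bondReadingY ∘ fst` on the torus of the k-level member).  The lane LOCATED (census v20, INTENT-0) the socket between the
two as (i) index restriction — in the tree (`B13EntryLetterAlgebra.rawEntryLetters_submatrix`), (ii) the identification of the term chart with
the road's chart and of the term reading with the road's, (iii) the FORMULA of the term operator — (ii) a pin of node00-def-T, (iii) NODE 00's.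
THIS FILE types socket (ii) IN KERNEL FORM ON THE LETTERS SIDE, positing neither a chart identity nor a formula: WHATEVER holomorphic (in
particular bounded-linear or affine) coordinate map the term chart is given INTO the road's chart, WHATEVER re-indexing, and WHATEVER reading
at bounded distortion from the road's (on the same or on another torus), a letters datum transports along them BY NAME with a located loss
`(R, ρ, B) ↦ ((R − ‖u₀‖)∕Λ, ρ∕κ, B·e^{(ρ∕κ)s})`.

WHAT THIS FILE PROVES (all `theorem`s; no `def`, no instance, no notation).
§1 CHART SOCKET ([Balaban1988RG2Cluster] p. 15: one analytic function of all the complex coordinates; [Balaban1985BackgroundPropagators] (3.36)):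
   `rawEntryLetters_comp` (a holomorphic map `φ` of the `R′`-ball of a chart `E′` into the `R`-ball of `E` pulls letters back at `(R′, ρ, B)`),
   `rawEntryLetters_comp_clm` (a bounded linear `φ` with `‖φ‖ ≤ Λ`, `0 < Λ`, `Λ·R′ ≤ R`), `rawEntryLetters_comp_linearIsometry` (radius kept),
   `rawEntryLetters_recentre` (`u ↦ Δ(u₀ + u)` on `‖u₀‖ + R′ ≤ R`: a pencil about one background read inside a ball about another),
   `rawEntryLetters_comp_affine` (`v ↦ Δ(u₀ + φ v)`, `‖u₀‖ + Λ·R′ ≤ R`), `rawEntryLetters_smul_arg` (`u ↦ Δ(c·u)`, `‖c‖·R′ ≤ R`),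
   `rawEntryLetters_comp_fst` ∕ `rawEntryLetters_comp_snd` (a family depending on one factor of a product chart keeps its letters on the
   product chart — a factor of a (2.14) term analytic in fewer of the variables `(𝐔, 𝐉, σ, τ)`).
§2 INDEX SOCKET ([Balaban1985BackgroundPropagators] (3.108): an entrywise property): `rawEntryLetters_reindex` (`Matrix.reindex e e` along an
   equivalence, located by `loc ∘ e.symm` — the by-name complement of `rawEntryLetters_submatrix`), `rawEntryLetters_of_submatrix_equiv`
   (converse: letters of the `e`-reindexed family along an EQUIVALENCE give back the letters of the family).
§3 READING SOCKET ([Balaban1988RG2Cluster] (2.5) p. 12, [Balaban1985BackgroundPropagators] (3.107): the decay is read through a distance of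
   the localizations; two readings of the same index at bounded distortion): `rawEntryLetters_of_reading_lipschitz` (a second reading `loc′`
   on ANY torus with `d₁′(loc′ i, loc′ j) ≤ κ·d₁(loc i, loc j) + s`, `0 < κ`, `0 ≤ ρ` ⟹ letters at `(R, ρ∕κ, B·e^{(ρ∕κ)s})`),
   `rawEntryLetters_of_reading_le` (`κ = 1`: constant `B·e^{ρs}`), `rawEntryLetters_of_reading_dist_le` (same torus, the two readings of
   every index within `s` of each other ⟹ constant `B·e^{2ρs}`).
§4 THE COMPOSITE SOCKET: ★ `rawEntryLetters_socket` (chart ∘ index ∘ reading in the displayed shape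
   `fun v => (Δ (u₀ + φ v)).submatrix e e` at the reading `loc′`, letters `((R, ρ, B) ↦ (R′, ρ∕κ, B·e^{(ρ∕κ)s}))` under `‖u₀‖ + Λ·R′ ≤ R`),
   `rawEntryLetters_socket_id` (A6 ∕ non-vacuity: the identity chart, identity index and the datum's own reading return `(R, ρ, B)` — every
   hypothesis of §4 is inhabited jointly and non-degenerately by ANY landed letters datum, e.g. the road's).
HONEST FRAMING: [folklore] bookkeeping; nothing of Bałaban's is constructed or asserted; WHICH coordinate map, re-indexing and reading the N10
term of record uses is node00-def-T's ∕ NODE 00's word (census v20 item 2 unchanged — this is NOT a junction edition); N10 NOT discharged;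
no registered stub proved; counts unmoved; one finite 𝕋⁴ programme at fixed ε — R4 closes the conditional finite-𝕋⁴ rung `BalabanLadder.UV`
only; nothing continuum ∕ ℝ⁴ ∕ OS ∕ mass gap ∕ Clay.  0 `sorry`, 0 `def`, standard axioms.

References: T. Bałaban, CMP 99 (1985) 389–434 [Balaban1985BackgroundPropagators] (3.36) p.396, (3.93) p.410, Thm 3.10 (3.107)–(3.108)
pp.415–416; CMP 116 (1988) 1–22 [Balaban1988RG2Cluster] (2.5) p.12, (2.14) p.15; CMP 96 (1984) 223–250 [Balaban1984PropagatorsII] p.232.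
-/

noncomputable section

namespace Literature.MathematicalPhysics.QuantumFieldTheory.Balaban1983to89.B13EntryLetterSockets

open Metric Set
open scoped Matrix
open Literature.MathematicalPhysics.QuantumFieldTheory.Balaban1983to89
open Literature.MathematicalPhysics.QuantumFieldTheory.Balaban1983to89.B9Thm37GlueTorus (tdist1 tdist1_nonneg tdist1_comm tdist1_triangle tdist1_self)
open Literature.MathematicalPhysics.QuantumFieldTheory.Balaban1983to89.B5TorusCover (UT)
open Literature.MathematicalPhysics.QuantumFieldTheory.Balaban1983to89.B13EntrywiseWalks (RawEntryLetters)
open Literature.MathematicalPhysics.QuantumFieldTheory.Balaban1983to89.B13EntryLetterAlgebra (rawEntryLetters_submatrix rawEntryLetters_mono)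

variable {ν : ℕ} {Nf : Fin ν → ℕ} [∀ i, NeZero (Nf i)]
variable {E E' : Type*} [NormedAddCommGroup E] [NormedSpace ℂ E] [NormedAddCommGroup E'] [NormedSpace ℂ E']
variable {p q : Type}

/-! ## §1. The chart socket — pulling letters back along a holomorphic coordinate map -/

section Chart

variable {Δ : E → Matrix p p ℂ} {loc : p → UT Nf} {R ρ B : ℝ}

/-- ★ **CHART PULLBACK**: a map `φ : E′ → E` holomorphic on the `R′`-ball and sending it into the `R`-ball pulls an entrywise-letters datum
of `Δ` back to one of `Δ ∘ φ`, with the same rate and constant ([Balaban1988RG2Cluster] p. 15: the (2.14) term is ONE analytic function of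
all its complex coordinates; [Balaban1985BackgroundPropagators] (3.36): the complex neighbourhood in whatever coordinates).
[cite: Balaban1988RG2Cluster, p.15; Balaban1985BackgroundPropagators, (3.36) p.396, (3.108) p.416] -/
theorem rawEntryLetters_comp (h : RawEntryLetters Δ loc R ρ B) {φ : E' → E} {R' : ℝ}
    (hφ : DifferentiableOn ℂ φ (ball (0 : E') R')) (hmaps : MapsTo φ (ball (0 : E') R') (ball (0 : E) R)) :
    RawEntryLetters (fun v => Δ (φ v)) loc R' ρ B where
  decay v hv i j := h.decay (φ v) (hmaps hv) i j
  holo i j := (h.holo i j).comp hφ hmaps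
  B_nonneg := h.B_nonneg

/-- **BOUNDED-LINEAR CHART MAP**: `φ : E′ →L[ℂ] E` with `‖φ‖ ≤ Λ`, `0 < Λ` sends the `R′`-ball into the `R`-ball once `Λ·R′ ≤ R`; the letters
pull back at `(R′, ρ, B)`. [cite: Balaban1988RG2Cluster, p.15; Balaban1985BackgroundPropagators, (3.108) p.416] -/
theorem rawEntryLetters_comp_clm (h : RawEntryLetters Δ loc R ρ B) (φ : E' →L[ℂ] E) {Λ R' : ℝ} (hφ : ‖φ‖ ≤ Λ) (hΛ : 0 < Λ)
    (hR' : Λ * R' ≤ R) : RawEntryLetters (fun v => Δ (φ v)) loc R' ρ B := by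
  refine rawEntryLetters_comp h φ.differentiable.differentiableOn fun v hv => ?_
  rw [mem_ball_zero_iff] at hv ⊢
  calc ‖φ v‖ ≤ ‖φ‖ * ‖v‖ := φ.le_opNorm v
    _ ≤ Λ * ‖v‖ := mul_le_mul_of_nonneg_right hφ (norm_nonneg v)
    _ < Λ * R' := mul_lt_mul_of_pos_left hv hΛ
    _ ≤ R := hR'

/-- **ISOMETRIC CHART MAP**: along a linear isometry the radius is kept. [cite: Balaban1985BackgroundPropagators, (3.108) p.416] -/
theorem rawEntryLetters_comp_linearIsometry (h : RawEntryLetters Δ loc R ρ B) (φ : E' →ₗᵢ[ℂ] E) :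
    RawEntryLetters (fun v => Δ (φ v)) loc R ρ B := by
  refine rawEntryLetters_comp h ?_ fun v hv => ?_
  · have := φ.toContinuousLinearMap.differentiable.differentiableOn (s := ball (0 : E') R)
    simpa only [LinearIsometry.coe_toContinuousLinearMap] using this
  · rw [mem_ball_zero_iff] at hv ⊢
    rwa [φ.norm_map]

/-- ★ **RECENTRING**: a letters datum on the `R`-ball about `0` gives one for `u ↦ Δ(u₀ + u)` on the `R′`-ball, `‖u₀‖ + R′ ≤ R` — a pencil about one
background read inside a ball about another ([Balaban1985BackgroundPropagators] Thm 3.4 p. 400: the extensions about every `U` of the class).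
[cite: Balaban1985BackgroundPropagators, Thm 3.4 p.400, (3.36) p.396, (3.108) p.416] -/
theorem rawEntryLetters_recentre (h : RawEntryLetters Δ loc R ρ B) (u₀ : E) {R' : ℝ} (hR' : ‖u₀‖ + R' ≤ R) :
    RawEntryLetters (fun u => Δ (u₀ + u)) loc R' ρ B := by
  refine rawEntryLetters_comp h ((differentiable_id.const_add u₀).differentiableOn) fun u hu => ?_
  rw [mem_ball_zero_iff] at hu ⊢
  calc ‖u₀ + u‖ ≤ ‖u₀‖ + ‖u‖ := norm_add_le _ _
    _ < ‖u₀‖ + R' := by linarith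
    _ ≤ R := hR'

/-- **AFFINE CHART MAP** `v ↦ u₀ + φ v` (`‖φ‖ ≤ Λ`, `0 < Λ`, `‖u₀‖ + Λ·R′ ≤ R`): letters at `(R′, ρ, B)`.
[cite: Balaban1988RG2Cluster, p.15; Balaban1985BackgroundPropagators, Thm 3.4 p.400, (3.108) p.416] -/
theorem rawEntryLetters_comp_affine (h : RawEntryLetters Δ loc R ρ B) (u₀ : E) (φ : E' →L[ℂ] E) {Λ R' : ℝ} (hφ : ‖φ‖ ≤ Λ)
    (hΛ : 0 < Λ) (hR' : ‖u₀‖ + Λ * R' ≤ R) : RawEntryLetters (fun v => Δ (u₀ + φ v)) loc R' ρ B :=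
  rawEntryLetters_comp_clm (rawEntryLetters_recentre h u₀ (R' := R - ‖u₀‖) (by linarith)) φ hφ hΛ (by linarith)

/-- **RESCALED COORDINATE** `u ↦ Δ(c·u)`, `c ≠ 0`, `‖c‖·R′ ≤ R`: letters at `(R′, ρ, B)` (e.g. the field-strength scale `η` of a pencil
`A′ ↦ e^{iηA′}U₀`). [cite: Balaban1985BackgroundPropagators, (3.36) p.396, (3.108) p.416] -/
theorem rawEntryLetters_smul_arg (h : RawEntryLetters Δ loc R ρ B) {c : ℂ} (hc : c ≠ 0) {R' : ℝ} (hR' : ‖c‖ * R' ≤ R) :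
    RawEntryLetters (fun u : E => Δ (c • u)) loc R' ρ B := by
  refine rawEntryLetters_comp h ((differentiable_id.const_smul c).differentiableOn) fun u hu => ?_
  rw [mem_ball_zero_iff] at hu ⊢
  calc ‖c • u‖ = ‖c‖ * ‖u‖ := norm_smul c u
    _ < ‖c‖ * R' := mul_lt_mul_of_pos_left hu (norm_pos_iff.2 hc)
    _ ≤ R := hR'

/-- **PRODUCT CHART, FIRST FACTOR**: a family depending on the first coordinate only keeps its letters on the product chart `E × E′` (sup norm:
the `R`-ball of the product projects into the `R`-ball of the factor) — a factor of a (2.14) term analytic in fewer of the variables.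
[cite: Balaban1988RG2Cluster, (2.14) p.15; Balaban1985BackgroundPropagators, (3.108) p.416] -/
theorem rawEntryLetters_comp_fst (h : RawEntryLetters Δ loc R ρ B) :
    RawEntryLetters (fun w : E × E' => Δ w.1) loc R ρ B := by
  refine rawEntryLetters_comp h differentiable_fst.differentiableOn fun w hw => ?_
  rw [mem_ball_zero_iff] at hw ⊢
  exact (norm_fst_le w).trans_lt hw

/-- **PRODUCT CHART, SECOND FACTOR**: the same for a family depending on the second coordinate only.
[cite: Balaban1988RG2Cluster, (2.14) p.15; Balaban1985BackgroundPropagators, (3.108) p.416] -/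
theorem rawEntryLetters_comp_snd {Δ' : E' → Matrix p p ℂ} (h : RawEntryLetters Δ' loc R ρ B) :
    RawEntryLetters (fun w : E × E' => Δ' w.2) loc R ρ B := by
  refine rawEntryLetters_comp h differentiable_snd.differentiableOn fun w hw => ?_
  rw [mem_ball_zero_iff] at hw ⊢
  exact (norm_snd_le w).trans_lt hw

end Chart

/-! ## §2. The index socket — re-indexing along an equivalence, both ways -/

section Index

variable {Δ : E → Matrix p p ℂ} {loc : p → UT Nf} {R ρ B : ℝ}

/-- **RE-INDEXING ALONG AN EQUIVALENCE** (`Matrix.reindex e e`), located by `loc ∘ e.symm` — the by-name complement of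
`B13EntryLetterAlgebra.rawEntryLetters_submatrix`. [cite: Balaban1985BackgroundPropagators, (3.108) p.416] -/
theorem rawEntryLetters_reindex (h : RawEntryLetters Δ loc R ρ B) (e : p ≃ q) :
    RawEntryLetters (fun u => Matrix.reindex e e (Δ u)) (loc ∘ e.symm) R ρ B :=
  rawEntryLetters_submatrix h e.symm

/-- **CONVERSE ALONG AN EQUIVALENCE**: letters of the `e`-reindexed family `u ↦ (Δ u).submatrix e e` (an equivalence `e : q ≃ p`) read at
`loc ∘ e` give back the letters of `Δ` read at `loc`. [cite: Balaban1985BackgroundPropagators, (3.108) p.416] -/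
theorem rawEntryLetters_of_submatrix_equiv (e : q ≃ p) (h : RawEntryLetters (fun u => (Δ u).submatrix e e) (loc ∘ e) R ρ B) :
    RawEntryLetters Δ loc R ρ B where
  decay u hu i j := by simpa using h.decay u hu (e.symm i) (e.symm j)
  holo i j := by simpa using h.holo (e.symm i) (e.symm j)
  B_nonneg := h.B_nonneg

end Index

/-! ## §3. The reading socket — a second reading of the index at bounded distortion -/

section Reading

variable {Δ : E → Matrix p p ℂ} {loc : p → UT Nf} {R ρ B : ℝ}
variable {ν' : ℕ} {Nf' : Fin ν' → ℕ} [∀ i, NeZero (Nf' i)]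

/-- ★ **CHANGE OF READING AT BOUNDED DISTORTION, ANY TORUS**: a second reading `loc′ : p → UT Nf′` (possibly on another torus) with
`d₁′(loc′ i, loc′ j) ≤ κ·d₁(loc i, loc j) + s` for all index pairs, `0 < κ`, `0 ≤ ρ` ⟹ the datum reads at `loc′` with rate `ρ∕κ` and constant
`B·e^{(ρ∕κ)s}` ([Balaban1988RG2Cluster] (2.5): operators read through the unit-lattice distance of their localizations; the scaled distances
`d_k = (LM)^{-…}d` of the programme are such second readings). [cite: Balaban1988RG2Cluster, (2.5) p.12; Balaban1985BackgroundPropagators, (3.107)-(3.108) p.416] -/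
theorem rawEntryLetters_of_reading_lipschitz (h : RawEntryLetters Δ loc R ρ B) (hρ : 0 ≤ ρ) (loc' : p → UT Nf') {κ s : ℝ}
    (hκ : 0 < κ) (hcmp : ∀ i j, tdist1 Nf' (loc' i) (loc' j) ≤ κ * tdist1 Nf (loc i) (loc j) + s) :
    RawEntryLetters Δ loc' R (ρ / κ) (B * Real.exp (ρ / κ * s)) where
  decay u hu i j := by
    refine (h.decay u hu i j).trans ?_
    rw [mul_assoc, ← Real.exp_add]
    refine mul_le_mul_of_nonneg_left (Real.exp_le_exp.2 ?_) h.B_nonneg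
    -- `−ρ d ≤ (ρ/κ)s − (ρ/κ)d′` from `d′ ≤ κ d + s`
    have hρκ : 0 ≤ ρ / κ := div_nonneg hρ hκ.le
    have h1 : ρ / κ * tdist1 Nf' (loc' i) (loc' j) ≤ ρ / κ * (κ * tdist1 Nf (loc i) (loc j) + s) :=
      mul_le_mul_of_nonneg_left (hcmp i j) hρκ
    have h2 : ρ / κ * (κ * tdist1 Nf (loc i) (loc j)) = ρ * tdist1 Nf (loc i) (loc j) := by
      field_simp
    nlinarith [h1, h2]
  holo := h.holo
  B_nonneg := mul_nonneg h.B_nonneg (Real.exp_nonneg _)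

/-- **CHANGE OF READING, SAME SCALE** (`κ = 1`): `d₁′(loc′ i, loc′ j) ≤ d₁(loc i, loc j) + s` ⟹ letters at `(R, ρ, B·e^{ρs})`.
[cite: Balaban1988RG2Cluster, (2.5) p.12; Balaban1985BackgroundPropagators, (3.108) p.416] -/
theorem rawEntryLetters_of_reading_le (h : RawEntryLetters Δ loc R ρ B) (hρ : 0 ≤ ρ) (loc' : p → UT Nf') {s : ℝ}
    (hcmp : ∀ i j, tdist1 Nf' (loc' i) (loc' j) ≤ tdist1 Nf (loc i) (loc j) + s) :
    RawEntryLetters Δ loc' R ρ (B * Real.exp (ρ * s)) := by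
  have := rawEntryLetters_of_reading_lipschitz h hρ loc' one_pos (s := s) (fun i j => by rw [one_mul]; exact hcmp i j)
  simpa only [div_one] using this

omit [∀ i, NeZero (Nf' i)] in
/-- **TWO READINGS ON THE SAME TORUS WITHIN `s` OF EACH OTHER** (`d₁(loc i, loc′ i) ≤ s` for every index) ⟹ letters at `(R, ρ, B·e^{2ρs})`
(triangle inequality twice). [cite: Balaban1988RG2Cluster, (2.5) p.12; Balaban1985BackgroundPropagators, (3.108) p.416] -/
theorem rawEntryLetters_of_reading_dist_le (h : RawEntryLetters Δ loc R ρ B) (hρ : 0 ≤ ρ) (loc' : p → UT Nf) {s : ℝ}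
    (hd : ∀ i, tdist1 Nf (loc i) (loc' i) ≤ s) :
    RawEntryLetters Δ loc' R ρ (B * Real.exp (ρ * (2 * s))) := by
  refine rawEntryLetters_of_reading_le h hρ loc' fun i j => ?_
  calc tdist1 Nf (loc' i) (loc' j) ≤ tdist1 Nf (loc' i) (loc i) + tdist1 Nf (loc i) (loc' j) := tdist1_triangle _ _ _
    _ ≤ tdist1 Nf (loc' i) (loc i) + (tdist1 Nf (loc i) (loc j) + tdist1 Nf (loc j) (loc' j)) :=
        add_le_add le_rfl (tdist1_triangle _ _ _)
    _ ≤ s + (tdist1 Nf (loc i) (loc j) + s) := by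
        refine add_le_add ?_ (add_le_add le_rfl (hd j))
        rw [tdist1_comm]; exact hd i
    _ = tdist1 Nf (loc i) (loc j) + 2 * s := by ring

end Reading

/-! ## §4. The composite socket, in the displayed shape of the junction's `hEL` -/

section Socket

variable {Δ : E → Matrix p p ℂ} {loc : p → UT Nf} {R ρ B : ℝ}
variable {ν' : ℕ} {Nf' : Fin ν' → ℕ} [∀ i, NeZero (Nf' i)]

/-- ★ **THE COMPOSITE SOCKET** (chart ∘ index ∘ reading): from a letters datum of `Δ` on the `R`-ball of `E` at reading `loc`, rate `ρ ≥ 0`,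
constant `B` — for ANY affine coordinate map `v ↦ u₀ + φ v` of another chart `E′` (`‖φ‖ ≤ Λ`, `0 < Λ`, `‖u₀‖ + Λ·R′ ≤ R`), ANY re-indexing
`e : q → p` and ANY reading `loc′ : q → UT Nf′` with `d₁′(loc′ a, loc′ b) ≤ κ·d₁(loc (e a), loc (e b)) + s` (`0 < κ`): the family
`v ↦ (Δ (u₀ + φ v)).submatrix e e` has letters at `(R′, ρ∕κ, B·e^{(ρ∕κ)s})` read at `loc′` — the shape of the N10 junction's `hEL`.
[cite: Balaban1988RG2Cluster, (2.5) p.12, p.15; Balaban1985BackgroundPropagators, Thm 3.4 p.400, Thm 3.10 (3.107)-(3.108) p.416] -/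
theorem rawEntryLetters_socket (h : RawEntryLetters Δ loc R ρ B) (hρ : 0 ≤ ρ) (u₀ : E) (φ : E' →L[ℂ] E) {Λ R' : ℝ}
    (hφ : ‖φ‖ ≤ Λ) (hΛ : 0 < Λ) (hR' : ‖u₀‖ + Λ * R' ≤ R) (e : q → p) (loc' : q → UT Nf') {κ s : ℝ} (hκ : 0 < κ)
    (hcmp : ∀ a b, tdist1 Nf' (loc' a) (loc' b) ≤ κ * tdist1 Nf (loc (e a)) (loc (e b)) + s) :
    RawEntryLetters (fun v => (Δ (u₀ + φ v)).submatrix e e) loc' R' (ρ / κ) (B * Real.exp (ρ / κ * s)) :=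
  rawEntryLetters_of_reading_lipschitz (rawEntryLetters_submatrix (rawEntryLetters_comp_affine h u₀ φ hφ hΛ hR') e) hρ loc' hκ hcmp

/-- **A6 ∕ NON-VACUITY OF THE SOCKET**: at the identity chart map (`u₀ = 0`, `φ = id`, `Λ = 1`), the identity index and the datum's own reading
(`κ = 1`, `s = 0`) the composite socket returns the datum's own letters `(R, ρ, B)` — so every hypothesis of `rawEntryLetters_socket` is
inhabited jointly, non-degenerately, by any landed letters datum. [cite: Balaban1985BackgroundPropagators, (3.108) p.416] -/
theorem rawEntryLetters_socket_id (h : RawEntryLetters Δ loc R ρ B) (hρ : 0 ≤ ρ) :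
    RawEntryLetters (fun v => (Δ ((0 : E) + ContinuousLinearMap.id ℂ E v)).submatrix id id) loc R (ρ / 1) (B * Real.exp (ρ / 1 * 0)) :=
  rawEntryLetters_socket h hρ 0 (ContinuousLinearMap.id ℂ E) ContinuousLinearMap.norm_id_le one_pos (by simp) id loc one_pos
    (fun a b => by simp)

/-- The identity socket's conclusion IS the datum (all three losses vanish). [cite: Balaban1985BackgroundPropagators, (3.108) p.416] -/
theorem rawEntryLetters_socket_id_iff :
    RawEntryLetters (fun v => (Δ ((0 : E) + ContinuousLinearMap.id ℂ E v)).submatrix id id) loc R (ρ / 1) (B * Real.exp (ρ / 1 * 0)) ↔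
      RawEntryLetters Δ loc R ρ B := by
  simp only [zero_add, ContinuousLinearMap.coe_id', id_eq, Matrix.submatrix_id_id, div_one, mul_zero, Real.exp_zero, mul_one]

end Socket

end Literature.MathematicalPhysics.QuantumFieldTheory.Balaban1983to89.B13EntryLetterSockets
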